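import Summits.ResolutionOfSingularities.ResolutionOfSingularities.Theorems.WeightedInvariantQuasiRegularWeightedMonomialsPrimary
import Summits.ResolutionOfSingularities.ResolutionOfSingularities.Theorems.WeightedInvariantQuasiRegularLocalToGlobal
import Mathlib.RingTheory.Localization.Ideal
import HarnessLib

/-!
# Weighted-chart pieces are primary in the ring of sections (local-to-global), and are contracted from the
# generic point of the centre

Route `ResolutionOfSingularities/WeightedInvariant`, door crux `HypersurfaceCentreConstruction`
(stmt-ResolutionOfSingularities-19897) — OURS, helper; e-ladder plan of `res-L1-w43-stub-10`, sub-lemma L0-η of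
`stub_e1_centre` (`D/res-D-pv-025/DOOR-ELADDER-PLAN.md` §7: «on the AQS chart the contraction IS the chart Rees
algebra»).  Ring-level form, for the ring of sections `A = Γ(Y, U′)` of an affine chart: the hypotheses are what the
stalks give (quasi-regularity and primeness of `(u)` in each `A_𝔪`, `𝔪 ⊇ (u)` maximal — i.e. `u` is part of a
regular system of parameters at every point of the centre) plus irreducibility of `V(u)` (`√(u)` prime):

* `isRadical_of_localization_maximal`, `isPrime_of_isPrime_radical_of_localization_maximal` — an ideal that is
  prime in every localisation at a maximal ideal containing it is radical; if moreover its radical is prime, it is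
  prime;
* `isPrimary_span_weightedMonomials_of_localization_maximal` — **the pieces `𝒥ₙ = (u^α : w·α ≥ n)` are
  `(u)`-primary in `A`** (local quasi-regularity ⇒ global, `isQuasiRegular_of_localization_maximal`; then
  `isPrimary_span_weightedMonomials`);
* `under_map_span_weightedMonomials_eq` — **hence `𝒥ₙ` is CONTRACTED from any localisation at a prime `𝔭 ⊇ (u)`**
  (in particular from the local ring at the generic point of `V(u)`): `(𝒥ₙ S) ∩ A = 𝒥ₙ`
  (`IsLocalization.under_map_of_isPrimary_disjoint`).  This is the equality «germ contraction of the chart = chart»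
  read in the ring of sections.

Pure commutative algebra; no named facts.
-/

noncomputable section

set_option linter.dupNamespace false -- mandated namespace of this single-conjunct summit

namespace Summit.ResolutionOfSingularities.ResolutionOfSingularities.Theorems

universe u

open Literature.AlgebraicGeometry.Resolution

variable {A : Type u} [CommRing A]

/-! ## Primeness local-to-global -/

/-- An ideal which is prime (in particular radical) in every localisation at a maximal ideal containing it is
radical. [folklore] -/
theorem isRadical_of_localization_maximal (I : Ideal A)
    (hloc : ∀ (P : Ideal A) [P.IsMaximal], I ≤ P → (I.map (algebraMap A (Localization.AtPrime P))).IsPrime) :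
    I.IsRadical := by
  intro x hx
  obtain ⟨k, hk⟩ := hx
  refine Ideal.mem_of_localization_maximal fun P hP => ?_
  by_cases hle : I ≤ P
  · haveI := hloc P hle
    have : algebraMap A (Localization.AtPrime P) x ^ k ∈ I.map (algebraMap A (Localization.AtPrime P)) := by
      rw [← map_pow]; exact Ideal.mem_map_of_mem _ hk
    exact Ideal.IsPrime.mem_of_pow_mem ‹_› k this
  · rw [IsLocalization.AtPrime.map_eq_top_of_not_le _ hle]
    exact Submodule.mem_top

/-- An ideal with PRIME radical which is prime in every localisation at a maximal ideal containing it is prime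
(it is radical, hence equal to its radical). [folklore] -/
theorem isPrime_of_isPrime_radical_of_localization_maximal (I : Ideal A) (hrad : I.radical.IsPrime)
    (hloc : ∀ (P : Ideal A) [P.IsMaximal], I ≤ P → (I.map (algebraMap A (Localization.AtPrime P))).IsPrime) :
    I.IsPrime := by
  rw [← (isRadical_of_localization_maximal I hloc).radical]
  exact hrad

/-! ## Weighted pieces in the ring of sections -/

variable {m : ℕ} (u : Fin m → A) (w : Fin m → ℕ)

/-- **Weighted-chart pieces are primary in the ring of sections.**  If `√(u)` is prime (the centre `V(u)` is
irreducible) and at every maximal ideal `𝔪 ⊇ (u)` the family `u` is quasi-regular in `A_𝔪` with `(u)A_𝔪` prime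
(both hold when `u` is part of a regular system of parameters of the regular local ring `A_𝔪`:
`isQuasiRegular_of_linearIndependent_toCotangent`, `isPrime_span_image_of_linearIndependent_toCotangent`), then for
positive weights and `n ≥ 1` the piece `𝒥ₙ = Ideal.span (weightedMonomials u w n)` is `(u)`-primary with radical
`(u)`. [folklore] -/
theorem isPrimary_span_weightedMonomials_of_localization_maximal (hw : ∀ i, 0 < w i) {n : ℕ} (hn : 1 ≤ n)
    (hrad : (Ideal.span (Set.range u)).radical.IsPrime)
    (hloc : ∀ (P : Ideal A) [P.IsMaximal], Ideal.span (Set.range u) ≤ P →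
      IsQuasiRegular (algebraMap A (Localization.AtPrime P) ∘ u) ∧
      ((Ideal.span (Set.range u)).map (algebraMap A (Localization.AtPrime P))).IsPrime) :
    (Ideal.span (weightedMonomials u w n)).IsPrimary ∧
      (Ideal.span (weightedMonomials u w n)).radical = Ideal.span (Set.range u) := by
  have hq : IsQuasiRegular u := isQuasiRegular_of_localization_maximal u fun P _ hP => (hloc P hP).1
  have hprime : (Ideal.span (Set.range u)).IsPrime :=
    isPrime_of_isPrime_radical_of_localization_maximal _ hrad fun P _ hP => (hloc P hP).2
  exact ⟨isPrimary_span_weightedMonomials u w hq hw hn hprime,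
    radical_span_weightedMonomials u w hw hn hprime.isRadical⟩

/-- **Weighted-chart pieces are contracted from the generic point of the centre.**  Under the hypotheses of
`isPrimary_span_weightedMonomials_of_localization_maximal`, for every prime `𝔭 ⊇ (u)` and every localisation
`S` of `A` at `𝔭` (e.g. the local ring at the generic point of `V(u)`, `𝔭 = √(u)`), the extension-contraction of
`𝒥ₙ` is `𝒥ₙ`: `(𝒥ₙ S).under A = 𝒥ₙ`. [folklore] -/
theorem under_map_span_weightedMonomials_eq (hw : ∀ i, 0 < w i) {n : ℕ} (hn : 1 ≤ n)
    (hrad : (Ideal.span (Set.range u)).radical.IsPrime)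
    (hloc : ∀ (P : Ideal A) [P.IsMaximal], Ideal.span (Set.range u) ≤ P →
      IsQuasiRegular (algebraMap A (Localization.AtPrime P) ∘ u) ∧
      ((Ideal.span (Set.range u)).map (algebraMap A (Localization.AtPrime P))).IsPrime)
    (𝔭 : Ideal A) [𝔭.IsPrime] (h𝔭 : Ideal.span (Set.range u) ≤ 𝔭)
    (S : Type u) [CommRing S] [Algebra A S] [IsLocalization.AtPrime S 𝔭] :
    ((Ideal.span (weightedMonomials u w n)).map (algebraMap A S)).under A =
      Ideal.span (weightedMonomials u w n) := by
  obtain ⟨hprim, hradical⟩ :=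
    isPrimary_span_weightedMonomials_of_localization_maximal u w hw hn hrad hloc
  refine IsLocalization.under_map_of_isPrimary_disjoint 𝔭.primeCompl S hprim ?_
  exact Set.disjoint_left.mpr fun s hs hsQ => hs (h𝔭 (hradical ▸ Ideal.le_radical hsQ))

/-- The same, membership form: a section whose image in the localisation at `𝔭 ⊇ (u)` lies in the extended
piece already lies in the piece. [folklore] -/
theorem mem_span_weightedMonomials_of_algebraMap_mem (hw : ∀ i, 0 < w i) {n : ℕ} (hn : 1 ≤ n)
    (hrad : (Ideal.span (Set.range u)).radical.IsPrime)
    (hloc : ∀ (P : Ideal A) [P.IsMaximal], Ideal.span (Set.range u) ≤ P →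
      IsQuasiRegular (algebraMap A (Localization.AtPrime P) ∘ u) ∧
      ((Ideal.span (Set.range u)).map (algebraMap A (Localization.AtPrime P))).IsPrime)
    (𝔭 : Ideal A) [𝔭.IsPrime] (h𝔭 : Ideal.span (Set.range u) ≤ 𝔭)
    (S : Type u) [CommRing S] [Algebra A S] [IsLocalization.AtPrime S 𝔭] {a : A}
    (ha : algebraMap A S a ∈ (Ideal.span (weightedMonomials u w n)).map (algebraMap A S)) :
    a ∈ Ideal.span (weightedMonomials u w n) := by
  have h := under_map_span_weightedMonomials_eq u w hw hn hrad hloc 𝔭 h𝔭 S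
  rw [← h]
  exact Ideal.mem_comap.mpr ha

end Summit.ResolutionOfSingularities.ResolutionOfSingularities.Theorems

end
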